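import Literature.NumberTheory.NumberFields.AbelianPExtensionCyclic
import Mathlib.NumberTheory.NumberField.Cyclotomic.Ideal
import Mathlib.NumberTheory.NumberField.Cyclotomic.Galois
import Mathlib.RingTheory.ZMod.UnitsCyclic
import HarnessLib

/-!
# Abelian extensions of `ℚ` of odd prime-power degree unramified outside `p` are cyclotomic

The odd prime-power case of the Kronecker–Weber theorem (Marcus, *Number Fields*, Ch. 4,
Ex. 36: an abelian extension of `ℚ` of degree `p^m`, `p` odd, in which `p` is the only ramified
prime, is the subfield of degree `p^m` of the `p^{m+1}`-st cyclotomic field), inside an ambient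
abelian number field `M₀` (which in the proof of Kronecker–Weber is the compositum of the field
under study with a cyclotomic field), ramification of subfields being expressed through inertia
subgroups of `Gal(M₀/ℚ)` (`isUnramifiedAt_under_iff_inertia_le`, `UnramifiedViaInertia.lean`):

* `isUnramifiedAt_of_isCyclotomicExtension` — `ℚ(ζₙ)` is unramified at the primes not dividing
  `n` (Mathlib's `IsCyclotomicExtension.Rat.ramificationIdx_eq_of_not_dvd`).
* `exists_cyclotomic_layer` — if `M₀ ⊇ Cy = ℚ(ζ_{p^{k+1}})`, the fixed field of the preimage of
  the `(p-1)`-torsion of `Gal(Cy/ℚ) ≅ (ℤ/p^{k+1})ˣ` (cyclic, `p` odd: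
  `ZMod.isCyclic_units_of_prime_pow`) is a subfield `C ≤ Cy` of degree `pᵏ` unramified outside `p`.
* `IntermediateField.le_of_isCyclotomicExtension_of_finrank_eq_odd_prime_pow` — any subfield
  `F ≤ M₀` of degree `pᵏ` unramified outside `p` equals `C`, hence `F ≤ Cy = ℚ(ζ_{p^{k+1}})`
  (`IntermediateField.eq_of_inertia_le_of_finrank_eq`).

## References

* D. A. Marcus, *Number Fields*, 2nd ed. (2018), Ch. 4, Ex. 36 (p. 103). [Marcus2018]
* L. C. Washington, *Introduction to Cyclotomic Fields*, 2nd ed. (1997), Ch. 14, proof of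
  Thm. 14.1 (the `p`-part). [Washington1997]
-/

noncomputable section

open NumberField Ideal
open scoped Pointwise IsMulCommutative

namespace Literature.NumberTheory.NumberFields

/-! ### Cyclotomic fields are unramified outside the primes dividing the level -/

/-- A maximal ideal of the ring of integers of the `n`-th cyclotomic field `ℚ(ζₙ)` which contains
no prime divisor of `n` is unramified over `ℤ` (Mathlib:
`IsCyclotomicExtension.Rat.ramificationIdx_eq_of_not_dvd`, `e = 1` for `p ∤ n`).
Ref: Washington, *Introduction to Cyclotomic Fields*, Prop. 2.3; Marcus, *Number Fields*, Ch. 3,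
Thm. 26 / Ch. 4, Ex. 38. [folklore] -/
theorem isUnramifiedAt_of_isCyclotomicExtension {n : ℕ} [NeZero n] (K : Type*) [Field K]
    [NumberField K] [IsCyclotomicExtension {n} ℚ K] (P : Ideal (𝓞 K)) [P.IsMaximal]
    (h : ∀ q : ℕ, q.Prime → (q : 𝓞 K) ∈ P → ¬ q ∣ n) : Algebra.IsUnramifiedAt ℤ P := by
  -- the rational prime `q` below `P`
  obtain ⟨g, hg⟩ := IsPrincipalIdealRing.principal (P.under ℤ)
  have hg0 : g ≠ 0 := by
    rintro rfl
    exact Ideal.IsMaximal.ne_bot_of_isIntegral_int P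
      (Ideal.eq_bot_of_comap_eq_bot (hg.trans (by simp)))
  set q := g.natAbs with hq
  have hspan : P.under ℤ = Ideal.span {(q : ℤ)} := by rw [hg, hq, Int.span_natAbs]
  haveI : (P.under ℤ).IsMaximal := Ideal.IsMaximal.under ℤ P
  have hqprime : q.Prime := by
    have h1 : (Ideal.span {(q : ℤ)}).IsPrime := hspan ▸ inferInstance
    rw [Ideal.span_singleton_prime (by exact_mod_cast Int.natAbs_ne_zero.mpr hg0 : (q : ℤ) ≠ 0)]
      at h1
    exact Nat.prime_iff_prime_int.mpr h1
  haveI : Fact q.Prime := ⟨hqprime⟩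
  haveI : P.LiesOver (Ideal.span {(q : ℤ)}) := ⟨hspan.symm⟩
  have hqP : (q : 𝓞 K) ∈ P := by
    have : algebraMap ℤ (𝓞 K) (q : ℤ) ∈ P :=
      (Ideal.mem_of_liesOver P (Ideal.span {(q : ℤ)}) (q : ℤ)).mp
        (Ideal.mem_span_singleton_self _)
    simpa using this
  have hqn : ¬ q ∣ n := h q hqprime hqP
  exact Ideal.ramificationIdx_eq_one_iff.mp
    (IsCyclotomicExtension.Rat.ramificationIdx_eq_of_not_dvd q K P hqn)

/-! ### The layer of degree `pᵏ` of `ℚ(ζ_{p^{k+1}})` inside an abelian number field -/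

variable {M₀ : Type*} [Field M₀] [NumberField M₀] [IsAbelianGalois ℚ M₀]

/-- **The cyclotomic layer.**  Let `M₀` be an abelian number field containing a `p^{k+1}`-st
cyclotomic field `Cy = ℚ(ζ_{p^{k+1}})` (`p` an odd prime).  Then `M₀` contains a subfield
`C ≤ Cy` of degree `pᵏ` over `ℚ` which is unramified outside `p` in the sense of
`isUnramifiedAt_under_iff_inertia_le` (`I(Q) ≤ Gal(M₀/C)` for every maximal `Q ∌ p`): the fixed
field of the elements of `Gal(Cy/ℚ) ≅ (ℤ/p^{k+1})ˣ` (cyclic of order `pᵏ(p-1)`) of order dividing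
`p - 1`.  (Marcus, Ch. 4, Ex. 36: "Let `L` be the unique subfield of the `p^{m+1}`-th cyclotomic
field having degree `p^m` over `ℚ`.") [cite: Marcus2018, Ch. 4, Ex. 36 (p. 103)] -/
theorem exists_cyclotomic_layer {p k : ℕ} (hp : p.Prime) (hp2 : p ≠ 2)
    (Cy : IntermediateField ℚ M₀) [IsCyclotomicExtension {p ^ (k + 1)} ℚ Cy] :
    ∃ C : IntermediateField ℚ M₀, C ≤ Cy ∧ Module.finrank ℚ C = p ^ k ∧
      ∀ (Q : Ideal (𝓞 M₀)) [Q.IsMaximal], (p : 𝓞 M₀) ∉ Q →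
        Q.inertia (M₀ ≃ₐ[ℚ] M₀) ≤ C.fixingSubgroup := by
  classical
  haveI : Fact p.Prime := ⟨hp⟩
  haveI : NeZero (p ^ (k + 1)) := ⟨pow_ne_zero _ hp.ne_zero⟩
  set HCy := Cy.fixingSubgroup with hHCy
  haveI : HCy.Normal := inferInstance
  haveI : IsGalois ℚ Cy := IsCyclotomicExtension.isGalois {p ^ (k + 1)} ℚ Cy
  -- `G/H_Cy ≅ Gal(Cy/ℚ) ≅ (ℤ/p^{k+1})ˣ` is cyclic of order `p^k (p-1)`
  have hfix : IntermediateField.fixedField HCy = Cy := IsGalois.fixedField_fixingSubgroup Cy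
  let f : (M₀ ≃ₐ[ℚ] M₀) →* (Cy ≃ₐ[ℚ] Cy) := AlgEquiv.restrictNormalHom Cy
  have hf : Function.Surjective f := AlgEquiv.restrictNormalHom_surjective M₀
  have hker : f.ker = HCy := Cy.restrictNormalHom_ker
  let e : (M₀ ≃ₐ[ℚ] M₀) ⧸ HCy ≃* (Cy ≃ₐ[ℚ] Cy) :=
    (QuotientGroup.quotientMulEquivOfEq hker.symm).trans
      (QuotientGroup.quotientKerEquivOfSurjective f hf)
  have hcardq : Nat.card ((M₀ ≃ₐ[ℚ] M₀) ⧸ HCy) = p ^ k * (p - 1) := by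
    rw [Nat.card_congr e.toEquiv, IsGalois.card_aut_eq_finrank,
      IsCyclotomicExtension.finrank Cy
        (Polynomial.cyclotomic.irreducible_rat (NeZero.pos (p ^ (k + 1)))),
      Nat.totient_prime_pow_succ hp]
  haveI : IsCyclic ((M₀ ≃ₐ[ℚ] M₀) ⧸ HCy) := by
    haveI := ZMod.isCyclic_units_of_prime_pow p hp hp2 (k + 1)
    haveI : IsCyclic (Cy ≃ₐ[ℚ] Cy) := isCyclic_of_surjective
      (IsCyclotomicExtension.Rat.galEquivZMod (p ^ (k + 1)) Cy).symm.toMonoidHom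
      (MulEquiv.surjective _)
    exact isCyclic_of_surjective e.symm.toMonoidHom e.symm.surjective
  -- `H_C`: the preimage of the `(p-1)`-torsion of `G/H_Cy`, of index `p^k`
  set T : Subgroup ((M₀ ≃ₐ[ℚ] M₀) ⧸ HCy) := (powMonoidHom (p - 1) : _ →* _).ker with hT
  set HC : Subgroup (M₀ ≃ₐ[ℚ] M₀) := T.comap (QuotientGroup.mk' HCy) with hHC
  have hle : HCy ≤ HC := by
    intro g hg
    rw [hHC, Subgroup.mem_comap, QuotientGroup.mk'_apply, (QuotientGroup.eq_one_iff g).mpr hg]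
    exact T.one_mem
  have hHCi : HC.index = p ^ k := by
    rw [hHC, Subgroup.index_comap_of_surjective _ (QuotientGroup.mk'_surjective HCy), hT,
      IsCyclic.index_powMonoidHom_ker, hcardq,
      Nat.gcd_eq_right (dvd_mul_left (p - 1) (p ^ k)),
      Nat.mul_div_cancel _ (by have := hp.two_le; omega)]
  refine ⟨IntermediateField.fixedField HC, ?_, ?_, ?_⟩
  · exact (IntermediateField.fixedField_le hle).trans hfix.le
  · rw [Literature.NumberTheory.GaloisRepresentations.finrank_fixedField_eq_card_quotient,
      ← Subgroup.index, hHCi]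
  · intro Q _ hpQ
    rw [IntermediateField.fixingSubgroup_fixedField]
    refine le_trans ?_ hle
    rw [hHCy, ← isUnramifiedAt_under_iff_inertia_le M₀ Cy Q]
    haveI : (Q.under (𝓞 Cy)).IsMaximal := Ideal.IsMaximal.under (𝓞 Cy) Q
    refine isUnramifiedAt_of_isCyclotomicExtension (n := p ^ (k + 1)) Cy (Q.under (𝓞 Cy)) ?_
    intro q hq hqQ hdvd
    have hqp : q = p := (Nat.prime_dvd_prime_iff_eq hq hp).mp (hq.dvd_of_dvd_pow hdvd)
    subst hqp
    apply hpQ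
    rw [Ideal.under_def, Ideal.mem_comap, map_natCast] at hqQ
    exact hqQ

/-! ### The odd prime-power case of Kronecker–Weber inside an abelian number field -/

/-- **Marcus, *Number Fields*, Ch. 4, Ex. 36: the case `[K : ℚ] = p^m`, `p` odd, `p` the only
ramified prime.**  Let `M₀` be an abelian number field containing a `p^{k+1}`-st cyclotomic field
`Cy` (`p` an odd prime) and let `F ≤ M₀` be a subfield of degree `pᵏ` over `ℚ` which is
unramified outside `p` (`I(Q) ≤ Gal(M₀/F)` for all maximal `Q ∌ p` of `𝓞 M₀`).  Then `F ≤ Cy`: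
`F` coincides with the layer of degree `pᵏ` of `Cy` (`exists_cyclotomic_layer`,
`IntermediateField.eq_of_inertia_le_of_finrank_eq`). [cite: Marcus2018, Ch. 4, Ex. 36 (p. 103)] -/
theorem IntermediateField.le_of_isCyclotomicExtension_of_finrank_eq_odd_prime_pow {p k : ℕ}
    (hp : p.Prime) (hp2 : p ≠ 2) (Cy : IntermediateField ℚ M₀)
    [IsCyclotomicExtension {p ^ (k + 1)} ℚ Cy] (F : IntermediateField ℚ M₀)
    (hF : Module.finrank ℚ F = p ^ k)
    (hFu : ∀ (Q : Ideal (𝓞 M₀)) [Q.IsMaximal], (p : 𝓞 M₀) ∉ Q →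
      Q.inertia (M₀ ≃ₐ[ℚ] M₀) ≤ F.fixingSubgroup) :
    F ≤ Cy := by
  obtain ⟨C, hCle, hC, hCu⟩ := exists_cyclotomic_layer (M₀ := M₀) hp hp2 Cy (k := k)
  rw [IntermediateField.eq_of_inertia_le_of_finrank_eq hp hp2 F C hF hC hFu hCu]
  exact hCle

end Literature.NumberTheory.NumberFields
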